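import Literature.NumberTheory.ConnesConsani2021.SpectralCertificate
import Literature.NumberTheory.ConnesConsani2021.ProlateEigenvaluePolynomialDecay
import Literature.NumberTheory.ConnesConsani2021.EpsSlopeEnclosure
import HarnessLib

/-!
# The kernel `ϖ` of `𝐊_I` for THE prolate family, and the (E-a) enclosure as ONE real inequality

RH-FREE corpus literature (label, line 1): bookkeeping for Connes–Consani's archimedean kernel
`ϖ(x) = (Qε)(exp|x|)/(2ε′(1₊))` (§6.3 p. 24); nothing in this file mentions `ζ`, the critical strip or
RH, and nothing here bears on the truth of RH.  bears_on (cell rh-crit, corpus C1): apex input (C) —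
route «ConnesConsaniSemilocal» item K3 `WindowSpectralBound` (stmt 19306), whose ONLY remaining
literature input is the (E-a) conjunct of `CC2021_section6_enclosures` (`SpectralCertificate.lean`).

STATUS OF THE CERTIFICATE HALF (cell rulings, 2026-08-26): director-rh 07:13:15Z — the in-kernel
(E-a) certificate (engine + `decide`, design `cc/engine/cert/ea_design_j251673.json`) is NOT STAFFED
this wave; cc-lead R93 (3) — this file is the 0-kit ANALYTIC FRAME ONLY (Tier 1): it proves no
enclosure and changes no certificate; the kernel certificate (Tier 2) is DEFERRED to a later wave.

## What is here (theorems + one definition; no named fact, no numerics)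

* `prolateVarpi` — CC's printed kernel `ϖ` ITSELF, for THE even prolate family `prolateFun`
  (§6.3 p. 24: `ϖ(x) := (Qε)(exp|x|)/(2ε′(1₊))`), written as the G-free real function
  `v ↦ (Σ' n, τ(n)T_n(e^{|v|})) / (2 Σ' n, t(n))` — numerator = the series (97)/(98) of Prop. 5.3
  (`sonineQTerm`, seat t6; `CC2021_prop_5_3_holds`), denominator = Lemma 5.4's slope
  `ε′(1₊) = Σ t(n)` (`epsSlopeTerm`; `CC2021_lemma_5_4_holds`).
* `IsArchDensity.opQ_eq_opQ_epsDensity`, `opQ_epsDensity_eq_mulOpQ`,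
  `hasSum_sonineQTerm_opQ_of_isArchDensity` — for ANY `C²` archimedean density `G` (route predicate
  `IsArchDensity`: `G = ε∘exp` on `[0,∞)`) and `y > 0`, `(QG)(y) = Σ' τ(n)T_n(e^y)`;
* **`varpi_eq_prolateVarpi`** — `ϖ_G(v) = prolateVarpi v` for EVERY `v` (at `v = 0` both vanish:
  Rem. 5.6 `CC2021_rem_5_6_holds` and `sonineQTerm … 1 = 0`): the kernel `ϖ_G = varpi G` of the
  certificate statement `SpectralCert.AnalyticInputValid G` does not depend on the branch `G`;
* **`analyticInputValid_iff`, `forall_analyticInputValid_iff_L1`, `section6_enclosures_iff_L1`** —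
  (E-a), and (with t15's kernel theorem `SlopeCert.epsSlope_enclosure_holds` for (E-b)) the WHOLE
  named fact `CC2021_section6_enclosures`, are EQUIVALENT to the single real inequality
  `∫_{[−log 2, log 2]} |τ_c(v) − prolateVarpi v| dv ≤ 1/400` about Slepian's `λ = 1` prolate family
  and the certificate kernel `τ_c` (`SpectralCert.frameKernel`, data `SpectralCert.CertAF`) — no
  `∀ G` left.  This is the statement a future Tier-2 certificate has to decide.

Sources: A. Connes, C. Consani, *Weil positivity and trace formula, the archimedean place*, Selecta
Math. (N.S.) 27 (2021) 77 = arXiv:2006.13771 [bib `ConnesConsani2021`]: §5 Prop. 5.3 eqs. (97)–(99)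
p. 32, Lemma 5.4 pp. 32–33, Rem. 5.6 p. 34, Prop. 5.5 (ii) pp. 20–21 (arXiv numbering), §6.3–6.4
p. 24 (definition of `ϖ`, Fact 6.1, Lemma 6.3).

WHAT THIS FILE IS NOT: an enclosure of `ϖ`, a discharge of (E-a), or anything about RH.
-/

noncomputable section

open Real Set MeasureTheory Filter Topology
open scoped InnerProductSpace

namespace Literature.NumberTheory.ConnesConsani2021

open Literature.NumberTheory.LFunctions

/-! ## `Q` is local; `(QG)(y)` for an archimedean density -/

/-- `(Qh)(y) = −h″(y) + h(y)/4` depends only on the germ of `h` at `y`. [cite: ConnesConsani2021, Lemma 3.3 eq. (55) §3 p. 18] -/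
theorem opQ_congr_of_eventuallyEq {h₁ h₂ : ℝ → ℂ} {y : ℝ} (h : h₁ =ᶠ[𝓝 y] h₂) :
    opQ h₁ y = opQ h₂ y := by
  have hd : deriv h₁ =ᶠ[𝓝 y] deriv h₂ := h.deriv
  rw [opQ_apply, opQ_apply, hd.deriv_eq, h.eq_of_nhds]

/-- RH-FREE. An archimedean density agrees with `ε ∘ exp` near every `y > 0`.
[cite: ConnesConsani2021, §5 eq. (Eprime) p. 20 (arXiv chunk p0020:L107–110)] -/
theorem IsArchDensity.eventuallyEq_epsDensity {G : ℝ → ℂ} (hGa : IsArchDensity G) {ψ : ℕ → ℝ → ℝ}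
    (hψ : ∀ n, IsProlateFunction 1 (2 * n) (ψ n)) {y : ℝ} (hy : 0 < y) :
    G =ᶠ[𝓝 y] epsDensity ψ := by
  filter_upwards [Ioi_mem_nhds hy] with x hx using hGa ψ hψ x (le_of_lt hx)

/-- RH-FREE. For `y > 0`, `(QG)(y) = (Q(ε∘exp))(y)` for every archimedean density `G`.
[cite: ConnesConsani2021, §5 Prop. 5.3 p. 32; Prop. 5.5 (ii) pp. 20–21] -/
theorem IsArchDensity.opQ_eq_opQ_epsDensity {G : ℝ → ℂ} (hGa : IsArchDensity G) {ψ : ℕ → ℝ → ℝ}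
    (hψ : ∀ n, IsProlateFunction 1 (2 * n) (ψ n)) {y : ℝ} (hy : 0 < y) :
    opQ G y = opQ (epsDensity ψ) y :=
  opQ_congr_of_eventuallyEq (hGa.eventuallyEq_epsDensity hψ hy)

/-- RH-FREE. **Additive ↔ multiplicative `Q` for CC's `ε`**: for `y > 0`,
`(Q(ε∘exp))(y) = (Qε)(e^y)` (`ε = ccEpsilon ψ` is `C²` on `(1,∞)` by Prop. 5.3 (i), a tree theorem).
[cite: ConnesConsani2021, Prop. 5.3 §5 p. 32 (arXiv item Prop. 30); Thm. 3.6 proof §3 p. 19] -/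
theorem opQ_epsDensity_eq_mulOpQ {ψ : ℕ → ℝ → ℝ} (hψ : ∀ n, IsProlateFunction 1 (2 * n) (ψ n))
    {y : ℝ} (hy : 0 < y) :
    opQ (epsDensity ψ) y = mulOpQ (ccEpsilon ψ) (Real.exp y) := by
  have hcd : ContDiffOn ℝ 2 (ccEpsilon ψ) (Ioi 1) := (CC2021_prop_5_3_holds ψ hψ).1
  have hρ : 1 < Real.exp y := Real.one_lt_exp_iff.mpr hy
  have hfun : (fun t ↦ ccEpsilon ψ (Real.exp t)) = epsDensity ψ := by
    funext t
    simp [ccEpsilon, Real.log_exp]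
  rw [← hfun]
  refine opQ_comp_exp ?_ ?_
  · filter_upwards [Ioi_mem_nhds hρ] with r hr
    exact (hcd.differentiableOn (by norm_num) r hr).differentiableAt (Ioi_mem_nhds hr)
  · obtain ⟨-, -, hC1⟩ := (contDiffOn_succ_iff_deriv_of_isOpen (n := 1) isOpen_Ioi).1 hcd
    have hd : DifferentiableAt ℝ (deriv (ccEpsilon ψ)) (Real.exp y) :=
      (hC1.differentiableOn one_ne_zero _ hρ).differentiableAt (Ioi_mem_nhds hρ)
    exact differentiableAt_id.smul hd

/-- RH-FREE. **`(QG)(y) = Σ' τ(n)T_n(e^y)` for every archimedean density and `y > 0`** — Prop. 5.3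
(ii) (`CC2021_prop_5_3_holds`) transported to the additive variable and to an arbitrary `C²` branch
`G` (only `IsArchDensity G` is used), for THE family `prolateFun` (`λ(n) = prolateEigen n`).
[cite: ConnesConsani2021, Prop. 5.3 eqs. (97)–(98) §5 p. 32 (arXiv item Prop. 30, chunk p0020:L59–L67)] -/
theorem hasSum_sonineQTerm_opQ_of_isArchDensity {G : ℝ → ℂ} (hGa : IsArchDensity G) {y : ℝ}
    (hy : 0 < y) :
    HasSum (fun n : ℕ ↦ ((sonineQTerm (prolateFun n) (prolateEigen n) (Real.exp y) : ℝ) : ℂ))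
      (opQ G y) := by
  have hψ := isProlateFunction_prolateFun
  have hρ : 1 < Real.exp y := Real.one_lt_exp_iff.mpr hy
  rw [hGa.opQ_eq_opQ_epsDensity hψ hy, opQ_epsDensity_eq_mulOpQ hψ hy]
  have e : ∀ n, prolateLambda (prolateFun n) = prolateEigen n := fun n ↦ rfl
  have h := (CC2021_prop_5_3_holds prolateFun hψ).2 (Real.exp y) hρ
  simp only [e] at h
  exact h

/-- RH-FREE. The term `τ(n)T_n(1)` vanishes: `sonineQTerm (prolateFun n) (λ(n)) 1 = 0` (the integral
over `[1,1]` is empty and the two boundary terms cancel by (74) at `x = 1`).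
[cite: ConnesConsani2021, Prop. 5.3 eq. (98) §5 p. 32; Rem. 5.6 p. 34] -/
theorem sonineQTerm_prolateFun_one (n : ℕ) : sonineQTerm (prolateFun n) (prolateEigen n) 1 = 0 := by
  have hf := isProlateFunction_prolateFun n
  have hc : ContinuousOn (prolateFun n) (Icc (-1) 1) := hf.contDiffOn.continuousOn
  have hd : DifferentiableWithinAt ℝ (prolateFun n) (Icc (-1) 1) 1 :=
    hf.contDiffOn.differentiableOn (by norm_num) 1 (right_mem_Icc.2 (by norm_num))
  exact sonineQTerm_one_eq_zero hc hd fun x hx ↦ cosTransform_prolateFun_eq hx n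

/-! ## CC's kernel `ϖ` for THE prolate family -/

/-- RH-FREE. **CC's kernel `ϖ(x) := (Qε)(exp|x|)/(2ε′(1₊))` for THE even prolate family** (§6.3 p. 24;
the Schwartz kernel `k(x,y) = ϖ(x−y)` of `𝐊_I`, Prop. 5.5 (ii)), as an explicit real function of the
prolate data: numerator the series (97)/(98) `Σ' τ(n)T_n(e^{|v|})` (`sonineQTerm`), denominator
`2ε′(1₊) = 2Σ' t(n)` (`epsSlopeTerm`, Lemma 5.4).  Even; equals `varpi G` for every archimedean
density `G` (`varpi_eq_prolateVarpi`).  Printed shape: kink at `0` with `ϖ(0) = 0`, `ϖ′(0⁺) ≈ 30.8`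
(NUMERICAL IN PRINT, Fig. 6 p. 24 — not asserted).
[cite: ConnesConsani2021, §6.3 p. 24 (definition of `ϖ`); Prop. 5.3 eqs. (97)–(98) p. 32; Lemma 5.4 pp. 32–33] -/
def prolateVarpi (v : ℝ) : ℝ :=
  (∑' n : ℕ, sonineQTerm (prolateFun n) (prolateEigen n) (Real.exp |v|)) /
    (2 * ∑' n : ℕ, epsSlopeTerm (prolateFun n))

/-- `prolateVarpi` unfolded. [cite: ConnesConsani2021, §6.3 p. 24] -/
theorem prolateVarpi_apply (v : ℝ) :
    prolateVarpi v = (∑' n : ℕ, sonineQTerm (prolateFun n) (prolateEigen n) (Real.exp |v|)) /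
      (2 * ∑' n : ℕ, epsSlopeTerm (prolateFun n)) := rfl

/-- `ϖ` is even. [cite: ConnesConsani2021, §6.3 p. 24] -/
theorem prolateVarpi_neg (v : ℝ) : prolateVarpi (-v) = prolateVarpi v := by
  simp [prolateVarpi, abs_neg]

/-- `ϖ(0) = 0` (every term `τ(n)T_n(1)` vanishes). [cite: ConnesConsani2021, Rem. 5.6 §5 p. 34] -/
theorem prolateVarpi_zero : prolateVarpi 0 = 0 := by
  simp [prolateVarpi, sonineQTerm_prolateFun_one]

/-- The slope `ε′(1₊) = Σ t(n)` is positive (indeed `≥ 22.9`, t15's kernel theorem).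
[cite: ConnesConsani2021, Lemma 5.4 §5 p. 33 ("`ε′(1₊) ≃ 22.9965`")] -/
theorem tsum_epsSlopeTerm_prolateFun_pos : 0 < ∑' n : ℕ, epsSlopeTerm (prolateFun n) := by
  have h := SlopeCert.tsum_epsSlopeTerm_prolateFun_mem.1
  linarith

/-- RH-FREE. **`ϖ_G = ϖ` for every archimedean density**: for `G ∈ C²(ℝ)` with `G = ε∘exp` on
`[0,∞)`, the kernel `varpi G v = (QG)(|v|)/(2G′(0))` of `𝐊_I` equals `prolateVarpi v` for EVERY `v`
(`v ≠ 0`: Prop. 5.3 + locality of `Q` + Lemma 5.4 `G′(0) = Σ t(n)`; `v = 0`: Rem. 5.6, both sides `0`).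
[cite: ConnesConsani2021, §6.3 p. 24; Prop. 5.3 p. 32; Lemma 5.4 pp. 32–33; Rem. 5.6 p. 34] -/
theorem varpi_eq_prolateVarpi {G : ℝ → ℂ} (hG : ContDiff ℝ 2 G) (hGa : IsArchDensity G) (v : ℝ) :
    varpi G v = ((prolateVarpi v : ℝ) : ℂ) := by
  rcases eq_or_ne v 0 with rfl | hv
  · rw [varpi_zero_of_rem_5_6 CC2021_rem_5_6_holds hG hGa, prolateVarpi_zero, Complex.ofReal_zero]
  · rw [varpi_apply, deriv_eq_tsum_epsSlopeTerm_of_lemma_5_4 CC2021_lemma_5_4_holds hG hGa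
      isProlateFunction_prolateFun,
      ← (hasSum_sonineQTerm_opQ_of_isArchDensity hGa (abs_pos.mpr hv)).tsum_eq, prolateVarpi_apply,
      ← Complex.ofReal_tsum]
    push_cast
    ring

/-- RH-FREE. `ϖ` is continuous (it is the continuous kernel `varpi G` of any `C²` archimedean density,
and such densities exist: `exists_contDiff_isArchDensity_summable_free`).
[cite: ConnesConsani2021, §6.3 p. 24 (Fig. 6: "a small amount of smoothness")] -/
theorem continuous_prolateVarpi : Continuous prolateVarpi := by
  obtain ⟨G, hG, hGa, -⟩ := exists_contDiff_isArchDensity_summable_free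
  have hc : Continuous (varpi G) := continuous_varpi hG
  have he : prolateVarpi = fun v ↦ (varpi G v).re := by
    funext v
    rw [varpi_eq_prolateVarpi hG hGa v, Complex.ofReal_re]
  rw [he]
  exact Complex.continuous_re.comp hc

/-! ## (E-a) as ONE real inequality -/

/-- RH-FREE. **The analytic input of the Route A-F certificate, G-free**: for every `C²` archimedean
density `G`, `SpectralCert.AnalyticInputValid G` holds iff
`∫_{[−log 2, log 2]} |τ_c(v) − ϖ(v)| dv ≤ ε₁ = 1/400` with `ϖ = prolateVarpi` (the printed Fact 6.1-type
`L¹` estimate for the certificate's own kernel `τ_c = frameKernel … CertAF.c`).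
[cite: ConnesConsani2021, §6.4 Fact 6.1 + Lemma 6.3 p. 24; §6.3 p. 24 (definition of `ϖ`)] -/
theorem analyticInputValid_iff {G : ℝ → ℂ} (hG : ContDiff ℝ 2 G) (hGa : IsArchDensity G) :
    SpectralCert.AnalyticInputValid G ↔
      ∫ v in Icc (-Real.log 2) (Real.log 2),
          ‖SpectralCert.frameKernel (-(Real.log 2 / 2)) (Real.log 2 / 2) SpectralCert.CertAF.N
              (fun n ↦ (SpectralCert.CertAF.c n : ℝ)) v - ((prolateVarpi v : ℝ) : ℂ)‖
        ≤ ((SpectralCert.CertAF.ε₁ : ℚ) : ℝ) := by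
  have he : varpi G = fun v ↦ ((prolateVarpi v : ℝ) : ℂ) := funext (varpi_eq_prolateVarpi hG hGa)
  unfold SpectralCert.AnalyticInputValid
  rw [he]

/-- RH-FREE. **(E-a) for ALL branches ⟺ the one real inequality** (archimedean densities exist:
`exists_contDiff_isArchDensity_summable_free`). [cite: ConnesConsani2021, §6.4 Fact 6.1 + Lemma 6.3 p. 24] -/
theorem forall_analyticInputValid_iff_L1 :
    (∀ G : ℝ → ℂ, ContDiff ℝ 2 G → IsArchDensity G → SpectralCert.AnalyticInputValid G) ↔
      ∫ v in Icc (-Real.log 2) (Real.log 2),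
          ‖SpectralCert.frameKernel (-(Real.log 2 / 2)) (Real.log 2 / 2) SpectralCert.CertAF.N
              (fun n ↦ (SpectralCert.CertAF.c n : ℝ)) v - ((prolateVarpi v : ℝ) : ℂ)‖
        ≤ ((SpectralCert.CertAF.ε₁ : ℚ) : ℝ) := by
  constructor
  · intro h
    obtain ⟨G, hG, hGa, -⟩ := exists_contDiff_isArchDensity_summable_free
    exact (analyticInputValid_iff hG hGa).1 (h G hG hGa)
  · intro h G hG hGa
    exact (analyticInputValid_iff hG hGa).2 h

/-- RH-FREE. **K3's whole literature input as ONE real inequality**: the named numerical fact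
`CC2021_section6_enclosures` ((E-a) ∧ (E-b)) is EQUIVALENT to
`∫_{[−log 2, log 2]} |τ_c − ϖ| ≤ 1/400`, the (E-b) conjunct being the kernel theorem
`SlopeCert.epsSlope_enclosure_holds` (seat t15, cc/engine certificate decided by `decide`).  The
certificate deciding this inequality (Tier 2) is deferred (cell rulings quoted in the module
docstring); this theorem only isolates it.
[cite: ConnesConsani2021, §6.4 Fact 6.1 + Lemma 6.3 p. 24; Lemma 5.4 p. 33] -/
theorem section6_enclosures_iff_L1 :
    CC2021_section6_enclosures ↔
      ∫ v in Icc (-Real.log 2) (Real.log 2),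
          ‖SpectralCert.frameKernel (-(Real.log 2 / 2)) (Real.log 2 / 2) SpectralCert.CertAF.N
              (fun n ↦ (SpectralCert.CertAF.c n : ℝ)) v - ((prolateVarpi v : ℝ) : ℂ)‖
        ≤ ((SpectralCert.CertAF.ε₁ : ℚ) : ℝ) := by
  rw [CC2021_section6_enclosures, forall_analyticInputValid_iff_L1]
  exact ⟨fun h ↦ h.1, fun h ↦ ⟨h, SlopeCert.epsSlope_enclosure_holds⟩⟩

/-- RH-FREE. **Corollary for the route's K3 export**: the one real inequality implies the K3 shape
`WindowSpectralBound` over `IsArchDensity` (via `windowSpectralBound_of_section6Enclosures`).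
[cite: ConnesConsani2021, §6.7 Lemma 6.10 / Thm. 6.11 p. 28] -/
theorem windowSpectralBound_of_L1_prolateVarpi
    (h : ∫ v in Icc (-Real.log 2) (Real.log 2),
          ‖SpectralCert.frameKernel (-(Real.log 2 / 2)) (Real.log 2 / 2) SpectralCert.CertAF.N
              (fun n ↦ (SpectralCert.CertAF.c n : ℝ)) v - ((prolateVarpi v : ℝ) : ℂ)‖
        ≤ ((SpectralCert.CertAF.ε₁ : ℚ) : ℝ))
    (G : ℝ → ℂ) (hG : ContDiff ℝ 2 G) (hd : IsArchDensity G) :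
    ∃ a₀ : ℝ, 0 ≤ a₀ ∧ a₀ ≤ 0.0635 ∧
      ∀ ξ : Lp ℂ 2 (volume.restrict (Icc (-(Real.log 2 / 2)) (Real.log 2 / 2))),
        0 ≤ RCLike.re ⟪ξ, ξ - windowOp (-(Real.log 2 / 2)) (Real.log 2 / 2) (integrableOn_varpi hG _ _) ξ⟫_ℂ
          + a₀ * ‖⟪constVector (-(Real.log 2 / 2)) (Real.log 2 / 2), ξ⟫_ℂ‖ ^ 2 :=
  windowSpectralBound_of_section6Enclosures (section6_enclosures_iff_L1.2 h) G hG hd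

end Literature.NumberTheory.ConnesConsani2021

end
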